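import Summits.BirchSwinnertonDyer.Rank1Residual.O5.O5TransferCertificate
import Summits.BirchSwinnertonDyer.Rank1Residual.Additive.LocIrrOddPrimes
import Literature.NumberTheory.EllipticCurves.BSDRankZeroDensityProofs
import Literature.NumberTheory.EllipticCurves.LeadingTerm
import HarnessLib

/-!
# O5 — the B-facing READINGS of T27 assembled: T27-LOWER and T27-UPPER are consequences of T27
# granted Gross–Zagier–Kolyvagin and the Cassels–Tate pairing (cell `b2b-bsdres`, lane CLASS-CLOSURE,
# class O5; harvest seat 2, GEN 48, E103)

HONEST FRAMING (cell `b2b-bsdres`, run/shared/lean/b2b/bsd-rank1-residual/, verbatim in every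
file): the goal of the cell is to DELETE the COMBINATION-SHAPED residual classes of the
Birch–Swinnerton-Dyer formula for ALL analytic-rank `≤ 1` elliptic curves over `ℚ` — "full BSD
formula for every rank `≤ 1` curve in class `C`" assembled STRICTLY from published theorems — so
that the rank-`≤ 1` remainder becomes exactly the CONSTRUCTION-SHAPED classes, which are TYPED
(missing-input `Prop`s), NOT attempted. This is not "finishing BSD". Lane CLASS-CLOSURE: research
routes; no claim beyond the stated classes; nothing is booked here; no mark of `RESIDUAL-MAP.md`
moves; census numbers are EVIDENCE. THEOREMS ONLY (no definition, no named fact, no conjecture node;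
net named-fact debt `0`); every published theorem enters as one of the tree's existing named
Literature facts BY NAME; the node file `O5/O5TransferCertificate.lean` (o5-r1 GEN 10 / cc-typer-5
GEN 10, A-O5-23) is not touched.

## What this file does

`O5/O5TransferCertificate.lean` types T27 (`CrudeSelmerTransferThree`: along a mod-3 congruence
with `W[3]` irreducible, `|dim Sel₃(W) − dim Sel₃(G)| ≤ D(W,G)`) and its two B-facing readings
T27-LOWER `CrudeTransferLowerNineThree` and T27-UPPER `CrudeTransferUpperUnitThree` as
`@[conjecture]` THEOREM-CANDIDATES "given T27", with only the NUMERIC skeletons proved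
(`two_le_selmerDim_of_transfer`, `selmerDim_eq_zero_of_transfer`). This file supplies the three
classical inputs the skeletons ask for, from the tree, and assembles the readings:

* §1 `natCard_selmerGroup_three_eq_pow` — `#Sel₃(W) = 3 ^ selmerDimThree W`;
  **`mordellWeilRank_le_selmerDimThree`** — Kummer: `rank E(ℚ) ≤ dim Sel₃(E)` (the exact descent
  count `WeierstrassCurve.natCard_selmerGroup_eq`, Silverman X.4.2, a tree theorem);
  **`even_selmerDimThree_of_analyticRank_eq_zero`** — parity: for `r_an(W) = 0` and `W[3]`
  irreducible, `dim Sel₃(W)` is EVEN, granted Gross–Zagier–Kolyvagin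
  (`rank_eq_analyticRank_of_analyticRank_le_one`, registry A18: rank `0`, `Ш` finite) and the
  Cassels–Tate pairing (`WeierstrassCurve.exists_casselsTate_pairing`, registry A24) through the
  tree's comparison `exists_selmerRank_eq_add` (`s = t + corank + 2m`) with `t = 0` (Mazur: no
  rational `3`-torsion under irreducibility) and `corank = rank + corank Ш = 0`;
  `natCard_shaThreeTorsion_eq_pow_of_analyticRank_eq_zero` — then `#Ш(W)[3] = 3 ^ dim Sel₃(W)`.
* §2 **`crudeTransferLowerNine_of_transfer : A18 → A24 → CrudeSelmerTransferThree →
  CrudeTransferLowerNineThree`** — T27-LOWER IS a consequence of T27 (no other binder): transfer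
  `sG ≤ sW + D`, Kummer `rank G ≤ sG`, the companion inequality `D + 1 ≤ rank G`, parity ⟹
  `sW ≥ 2` ⟹ `9 ∣ #Ш(W)[3] ∣ #Ш(W)`.
* §3 **`crudeTransferUpperUnit_of_transfer_of_torsionFree`** — T27-UPPER from T27 for companions
  `G` with `G(ℚ)[3] = 0` made EXPLICIT (`Nat.card G(ℚ)[3] = 1`; the node's docstring calls it
  "automatic" — it is, by `ρ̄_G ≅ ρ̄_W` irreducible, i.e. Brauer–Nesbitt + Chebotarev on the
  congruence, which is not a tree theorem; `crudeTransferUpperUnit_of_transfer_of_irr` takes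
  `G.HasIrreducibleModPGaloisRep 3` instead): `sG = 0` (rank `0`, no `3`-torsion, `3 ∤ #Ш(G)`),
  transfer `sW ≤ D ≤ 1`, parity ⟹ `sW = 0` ⟹ `Ш(W)[3] = 0` ⟹ `3 ∤ #Ш(W)` (Cauchy).

T27 itself stays an `@[conjecture]` THEOREM-CANDIDATE (Greenberg–Wiles / Poitou–Tate bookkeeping,
derivation `HOME/b2b-bsdres-o5-r1/gen10/T27-TRANSFER-CERTIFICATE.md`, page checks E99): nothing here
asserts it. What the cell gains: the B-facing nodes T27-LOWER / T27-UPPER no longer carry untyped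
classical inputs — given T27 they follow from TWO registered facts (A18, A24).

References: J. H. Silverman, *AEC* (2009) Thm. X.4.2, X.4.14 [SilvermanAEC2009]; B. Mazur, Publ.
Math. IHÉS 47 (1977) III §5 p. 157 [Mazur1977]; H. Darmon, CBMS 101 (2004) Thm. 3.22
(Gross–Zagier–Kolyvagin) [Darmon2004]; J. W. S. Cassels, J. reine angew. Math. 211 (1962)
[Cassels1962ArithmeticIV]; cell: `O5/O5TransferCertificate.lean`, HOME/b2b-bsdres-harvest-2/gen48/E103.
-/

set_option autoImplicit false

noncomputable section

open scoped Classical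

open WeierstrassCurve Literature.NumberTheory.EllipticCurves
  Literature.NumberTheory.EllipticCurves.Rank1Residual
  Summit.BirchSwinnertonDyer.Rank1Residual.Additive

namespace Summit.BirchSwinnertonDyer.Rank1Residual.O5

/-! ## §1 The three classical inputs of the T27 skeletons, from the tree -/

section Inputs

variable (W : WeierstrassCurve ℚ) [W.IsElliptic]

/-- `#Sel₃(W) = 3 ^ dim Sel₃(W)` (`selmerDimThree W := v₃(#Sel₃ W)`; `#Sel₃` is a power of `3`,
`exists_natCard_selmerGroup_eq_pow`). [folklore] -/
theorem natCard_selmerGroup_three_eq_pow : Nat.card (W.selmerGroup 3) = 3 ^ selmerDimThree W := by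
  obtain ⟨s, hs⟩ := exists_natCard_selmerGroup_eq_pow W 3
  rw [Nat.cast_ofNat] at hs
  rw [selmerDimThree, hs, padicValNat.prime_pow]

/-- **Kummer: `rank E(ℚ) ≤ dim_{𝔽₃} Sel₃(E)`** — from the exact descent count
`#Sel₃ = 3^{rank} · #E(ℚ)[3] · #Ш[3]` (`WeierstrassCurve.natCard_selmerGroup_eq`).
[cite: SilvermanAEC2009, Thm. X.4.2] -/
theorem mordellWeilRank_le_selmerDimThree : W.mordellWeilRank ≤ selmerDimThree W := by
  have h := W.natCard_selmerGroup_eq (n := 3) (by norm_num)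
  rw [Nat.cast_ofNat] at h
  have hdvd : 3 ^ W.mordellWeilRank ∣ 3 ^ selmerDimThree W := by
    rw [← natCard_selmerGroup_three_eq_pow W, h, mul_assoc]
    exact dvd_mul_right _ _
  exact (Nat.pow_dvd_pow_iff_le_right (by norm_num)).mp hdvd

/-- **Parity: at analytic rank `0` with `W[3]` irreducible, `dim Sel₃(W)` is even**, granted
Gross–Zagier–Kolyvagin (A18: `rank W = 0`, `Ш(W)` finite) and the Cassels–Tate pairing (A24):
`s = t + corank + 2m` (`exists_selmerRank_eq_add`) with `t = 0` (no rational `3`-torsion,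
`natCard_torsionBy_eq_one_of_hasIrreducibleModPGaloisRep`) and `corank = rank + corank Ш = 0`
(`selmerCorank_eq_mordellWeilRank_add_holds`, `zpCorank_eq_zero_of_finite`).
[cite: SilvermanAEC2009, Thm. X.4.14] [cite: Darmon2004, Thm. 3.22] [cite: Mazur1977, Ch. III §5, p. 157] -/
theorem even_selmerDimThree_of_analyticRank_eq_zero
    (hGZK : rank_eq_analyticRank_of_analyticRank_le_one)
    (hCT : WeierstrassCurve.exists_casselsTate_pairing (K := ℚ))
    (hirr : W.HasIrreducibleModPGaloisRep 3) (hr : W.analyticRank = 0) : Even (selmerDimThree W) := by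
  obtain ⟨hrank, hfin⟩ := hGZK W (by omega)
  haveI : Finite W.sha := hfin
  have ht : Nat.card (AddSubgroup.torsionBy W.toAffine.Point ((3 : ℕ) : ℤ)) = 3 ^ 0 := by
    rw [pow_zero]; exact natCard_torsionBy_eq_one_of_hasIrreducibleModPGaloisRep W 3 hirr
  obtain ⟨m, hm⟩ := exists_selmerRank_eq_add hCT W 3 (selmerDimThree W) 0
    (by rw [Nat.cast_ofNat]; exact natCard_selmerGroup_three_eq_pow W) (by convert ht)
  have hsha : W.shaCorank 3 = 0 := zpCorank_eq_zero_of_finite _ 3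
  have hco : W.selmerCorank 3 = 0 := by
    rw [W.selmerCorank_eq_mordellWeilRank_add_holds 3, hrank, hr, hsha]
  exact ⟨m, by omega⟩

/-- **At analytic rank `0` with `W[3]` irreducible, `#Ш(W)[3] = 3 ^ dim Sel₃(W)`** (granted A18:
`rank W = 0`; `#E(ℚ)[3] = 1` by irreducibility; the descent count). Here `Ш[3]` is
`Ш ⊓ H¹(ℚ, E)[3] ≤ H¹(ℚ, E)`, as in `natCard_selmerGroup_eq`. [cite: SilvermanAEC2009, Thm. X.4.2]
[cite: Darmon2004, Thm. 3.22] -/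
theorem natCard_shaThreeTorsion_eq_pow_of_analyticRank_eq_zero
    (hGZK : rank_eq_analyticRank_of_analyticRank_le_one)
    (hirr : W.HasIrreducibleModPGaloisRep 3) (hr : W.analyticRank = 0) :
    Nat.card (W.sha ⊓ AddSubgroup.torsionBy W.galH1 3 : AddSubgroup W.galH1) =
      3 ^ selmerDimThree W := by
  obtain ⟨hrank, -⟩ := hGZK W (by omega)
  have h := W.natCard_selmerGroup_eq (n := 3) (by norm_num)
  rw [Nat.cast_ofNat] at h
  have ht : Nat.card (AddSubgroup.torsionBy W.toAffine.Point ((3 : ℕ) : ℤ)) = 1 :=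
    natCard_torsionBy_eq_one_of_hasIrreducibleModPGaloisRep W 3 hirr
  rw [Nat.cast_ofNat] at ht
  rw [natCard_selmerGroup_three_eq_pow W, hrank, hr, pow_zero, one_mul] at h
  -- (`convert` bridges the decidable-equality instance on `E(ℚ)` inside `natCard_selmerGroup_eq`)
  have e : 3 ^ selmerDimThree W =
      1 * Nat.card (W.sha ⊓ AddSubgroup.torsionBy W.galH1 3 : AddSubgroup W.galH1) := by
    convert h using 2
    convert ht.symm
  rw [one_mul] at e
  exact e.symm

/-- For a companion `G` of rank `0` with `Ш(G)` finite, `3 ∤ #Ш(G)` and no rational `3`-torsion: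
`dim Sel₃(G) = 0`. The `3`-torsion of `Ш(G)` is a `3`-group (`exists_natCard_eq_pow_of_nsmul_eq_zero`)
whose order divides `#Ш(G)`, hence is `1`; then the descent count gives `#Sel₃(G) = 1`.
[cite: SilvermanAEC2009, Thm. X.4.2] -/
theorem selmerDimThree_eq_zero_of_rank_zero (G : WeierstrassCurve ℚ) [G.IsElliptic]
    (hrk : G.mordellWeilRank = 0) (hfin : G.ShaFinite) (h3 : ¬ 3 ∣ G.shaOrder)
    (htors : Nat.card (AddSubgroup.torsionBy G.toAffine.Point 3) = 1) :
    selmerDimThree G = 0 := by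
  haveI : Finite G.sha := hfin
  haveI : Fact (Nat.Prime 3) := ⟨Nat.prime_three⟩
  have h := G.natCard_selmerGroup_eq (n := 3) (by norm_num)
  rw [Nat.cast_ofNat] at h
  set T : AddSubgroup G.galH1 := G.sha ⊓ AddSubgroup.torsionBy G.galH1 3 with hT
  -- `#T` is a power of `3` dividing `#Ш(G)`, so it is `1`
  have hTle : T ≤ G.sha := inf_le_left
  have hTdvd : Nat.card T ∣ G.shaOrder := AddSubgroup.card_dvd_of_le hTle
  haveI : Finite T := Finite.of_injective (AddSubgroup.inclusion hTle) (AddSubgroup.inclusion_injective hTle)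
  have hTpow : ∃ k : ℕ, Nat.card T = 3 ^ k := by
    refine exists_natCard_eq_pow_of_nsmul_eq_zero 3 fun x ↦ Subtype.ext ?_
    have hx : (3 : ℤ) • (x : G.galH1) = 0 := (x.2).2
    rw [AddSubgroupClass.coe_nsmul, ZeroMemClass.coe_zero, ← natCast_zsmul, Nat.cast_ofNat]
    exact hx
  obtain ⟨k, hk⟩ := hTpow
  have hk0 : k = 0 := by
    by_contra hk0
    apply h3
    have h3k : 3 ∣ 3 ^ k := dvd_pow_self 3 hk0
    exact h3k.trans (hk ▸ hTdvd)
  have hT1 : Nat.card T = 1 := by rw [hk, hk0, pow_zero]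
  rw [natCard_selmerGroup_three_eq_pow G, hrk, pow_zero, one_mul, hT1, mul_one] at h
  -- `3 ^ sG = #G(ℚ)[3] = 1` (`convert` bridges the decidable-equality instance on `E(ℚ)`)
  have e : 3 ^ selmerDimThree G = 1 := by
    convert h using 1
    convert htors.symm
  exact (Nat.pow_eq_one.mp e).resolve_left (by norm_num)

end Inputs

/-! ## §2 T27-LOWER is a consequence of T27 (granted A18 and A24) -/

/-- **T27 ⟹ T27-LOWER, granted Gross–Zagier–Kolyvagin (A18) and Cassels–Tate (A24).** For `W` of
analytic rank `0` with `W[3]` irreducible and a mod-3 congruent `G` with `rank G ≥ D(W,G) + 1`: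
transfer (`CrudeSelmerTransferThree`, second conjunct) `sG ≤ sW + D`, Kummer `rank G ≤ sG`
(`mordellWeilRank_le_selmerDimThree`), parity `Even sW` (`even_selmerDimThree_of_analyticRank_eq_zero`)
give `2 ≤ sW` (`two_le_selmerDim_of_transfer`); and `#Ш(W)[3] = 3^{sW}`
(`natCard_shaThreeTorsion_eq_pow_of_analyticRank_eq_zero`) divides `#Ш(W)`. So `9 ∣ #Ш(W)`.
[cite: SilvermanAEC2009, Thm. X.4.2 and X.4.14] [cite: Darmon2004, Thm. 3.22] -/
theorem crudeTransferLowerNine_of_transfer (hGZK : rank_eq_analyticRank_of_analyticRank_le_one)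
    (hCT : WeierstrassCurve.exists_casselsTate_pairing (K := ℚ)) (hT : CrudeSelmerTransferThree) :
    CrudeTransferLowerNineThree := by
  intro W G _ _ _ _ hirr hcong hr0 hD
  obtain ⟨-, hGW⟩ := hT W G hirr hcong
  have h2 : 2 ≤ selmerDimThree W :=
    two_le_selmerDim_of_transfer hGW (mordellWeilRank_le_selmerDimThree G) hD
      (even_selmerDimThree_of_analyticRank_eq_zero W hGZK hCT hirr hr0)
  have hsha := natCard_shaThreeTorsion_eq_pow_of_analyticRank_eq_zero W hGZK hirr hr0
  have hdvd : Nat.card (W.sha ⊓ AddSubgroup.torsionBy W.galH1 3 : AddSubgroup W.galH1) ∣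
      W.shaOrder := AddSubgroup.card_dvd_of_le inf_le_left
  have h9 : 9 ∣ 3 ^ selmerDimThree W := by
    obtain ⟨k, hk⟩ : ∃ k, selmerDimThree W = k + 2 := ⟨selmerDimThree W - 2, by omega⟩
    rw [hk, pow_add]
    exact dvd_mul_left _ _
  rw [← hsha] at h9
  exact h9.trans hdvd

/-! ## §3 T27-UPPER from T27 for companions without rational `3`-torsion -/

/-- **T27 ⟹ T27-UPPER for companions `G` with `G(ℚ)[3] = 0`, granted A18 and A24.** `W` of
analytic rank `0` with `W[3]` irreducible, `G` mod-3 congruent with `rank G = 0`, `Ш(G)` finite,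
`3 ∤ #Ш(G)`, `#G(ℚ)[3] = 1`, and `D(W,G) ≤ 1`: `sG = 0` (`selmerDimThree_eq_zero_of_rank_zero`),
transfer (first conjunct) `sW ≤ sG + D`, parity ⟹ `sW = 0` (`selmerDim_eq_zero_of_transfer`) ⟹
`#Ш(W)[3] = 1` ⟹ `3 ∤ #Ш(W)` (Cauchy in the finite group `Ш(W)`, A18). The hypothesis
`#G(ℚ)[3] = 1` is EXPLICIT here (the node calls it automatic — by `ρ̄_G ≅ ρ̄_W`, Brauer–Nesbitt +
Chebotarev, not a tree theorem). [cite: SilvermanAEC2009, Thm. X.4.2 and X.4.14] [cite: Darmon2004, Thm. 3.22] -/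
theorem crudeTransferUpperUnit_of_transfer_of_torsionFree
    (hGZK : rank_eq_analyticRank_of_analyticRank_le_one)
    (hCT : WeierstrassCurve.exists_casselsTate_pairing (K := ℚ)) (hT : CrudeSelmerTransferThree)
    (W G : WeierstrassCurve ℚ) [W.IsElliptic] [W.IsGloballyMinimal] [G.IsElliptic] [G.IsGloballyMinimal]
    (hirr : W.HasIrreducibleModPGaloisRep 3) (hcong : IsCongruentModThree W G) (hr0 : W.analyticRank = 0)
    (hrk : G.mordellWeilRank = 0) (hfin : G.ShaFinite) (h3 : ¬ 3 ∣ G.shaOrder)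
    (hD : crudeBudgetThree W G ≤ 1)
    (htors : Nat.card (AddSubgroup.torsionBy G.toAffine.Point 3) = 1) :
    ¬ 3 ∣ W.shaOrder := by
  obtain ⟨hWG, -⟩ := hT W G hirr hcong
  have hsG : selmerDimThree G = 0 := selmerDimThree_eq_zero_of_rank_zero G hrk hfin h3 htors
  have hsW : selmerDimThree W = 0 :=
    selmerDim_eq_zero_of_transfer hWG hsG hD (even_selmerDimThree_of_analyticRank_eq_zero W hGZK hCT hirr hr0)
  have hsha := natCard_shaThreeTorsion_eq_pow_of_analyticRank_eq_zero W hGZK hirr hr0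
  rw [hsW, pow_zero] at hsha
  -- `Ш(W)` is finite (A18) with trivial `3`-torsion: no element of order `3`
  obtain ⟨-, hfinW⟩ := hGZK W (by omega)
  haveI : Finite W.sha := hfinW
  haveI : Fintype W.sha := Fintype.ofFinite _
  intro h3W
  rw [shaOrder, Nat.card_eq_fintype_card] at h3W
  haveI : Fact (Nat.Prime 3) := ⟨Nat.prime_three⟩
  obtain ⟨x, hx⟩ := exists_prime_addOrderOf_dvd_card 3 h3W
  -- `x` lies in `Ш ⊓ H¹[3]`, a group of order `1`
  set T : AddSubgroup W.galH1 := W.sha ⊓ AddSubgroup.torsionBy W.galH1 3 with hT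
  have h3x : 3 • (x : W.galH1) = 0 := by
    rw [← AddSubgroupClass.coe_nsmul, ← hx, addOrderOf_nsmul_eq_zero, ZeroMemClass.coe_zero]
  have hz : ((3 : ℕ) : ℤ) • (x : W.galH1) = 0 := by rw [natCast_zsmul]; exact h3x
  rw [Nat.cast_ofNat] at hz
  have hxT : (x : W.galH1) ∈ T := ⟨x.2, hz⟩
  have h0T : (0 : W.galH1) ∈ T := T.zero_mem
  haveI : Finite T := Nat.finite_of_card_ne_zero (by rw [hsha]; exact one_ne_zero)
  have hsub : (⟨(x : W.galH1), hxT⟩ : T) = ⟨0, h0T⟩ :=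
    (Nat.card_eq_one_iff_unique.mp hsha).1.elim _ _
  have hx0 : (x : W.galH1) = 0 := congrArg Subtype.val hsub
  rw [← AddSubgroup.addOrderOf_coe, hx0, addOrderOf_zero] at hx
  norm_num at hx

/-- **T27 ⟹ T27-UPPER for companions `G` with `G[3]` irreducible** (then `#G(ℚ)[3] = 1` by
`natCard_torsionBy_eq_one_of_hasIrreducibleModPGaloisRep`), granted A18 and A24.
[cite: SilvermanAEC2009, Thm. X.4.2 and X.4.14] [cite: Mazur1977, Ch. III §5, p. 157] -/
theorem crudeTransferUpperUnit_of_transfer_of_irr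
    (hGZK : rank_eq_analyticRank_of_analyticRank_le_one)
    (hCT : WeierstrassCurve.exists_casselsTate_pairing (K := ℚ)) (hT : CrudeSelmerTransferThree)
    (W G : WeierstrassCurve ℚ) [W.IsElliptic] [W.IsGloballyMinimal] [G.IsElliptic] [G.IsGloballyMinimal]
    (hirr : W.HasIrreducibleModPGaloisRep 3) (hcong : IsCongruentModThree W G) (hr0 : W.analyticRank = 0)
    (hrk : G.mordellWeilRank = 0) (hfin : G.ShaFinite) (h3 : ¬ 3 ∣ G.shaOrder)
    (hD : crudeBudgetThree W G ≤ 1) (hirrG : G.HasIrreducibleModPGaloisRep 3) : ¬ 3 ∣ W.shaOrder :=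
  crudeTransferUpperUnit_of_transfer_of_torsionFree hGZK hCT hT W G hirr hcong hr0 hrk hfin h3 hD
    (by have h := natCard_torsionBy_eq_one_of_hasIrreducibleModPGaloisRep G 3 hirrG
        rwa [Nat.cast_ofNat] at h)

/-- **T27 ⟹ T27-UPPER (the node `CrudeTransferUpperUnitThree`) granted A18, A24 and the one
remaining classical input made explicit as a binder**: "a mod-3 congruent companion of a curve with
irreducible `W[3]` has no rational `3`-torsion" (`ρ̄_G ≅ ρ̄_W` by Brauer–Nesbitt–Chebotarev; untyped).
[cite: SilvermanAEC2009, Thm. X.4.2 and X.4.14] -/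
theorem crudeTransferUpperUnit_of_transfer (hGZK : rank_eq_analyticRank_of_analyticRank_le_one)
    (hCT : WeierstrassCurve.exists_casselsTate_pairing (K := ℚ)) (hT : CrudeSelmerTransferThree)
    (htors : ∀ (W G : WeierstrassCurve ℚ) [W.IsElliptic] [W.IsGloballyMinimal] [G.IsElliptic]
      [G.IsGloballyMinimal], W.HasIrreducibleModPGaloisRep 3 → IsCongruentModThree W G →
        Nat.card (AddSubgroup.torsionBy G.toAffine.Point 3) = 1) :
    CrudeTransferUpperUnitThree := by
  intro W G _ _ _ _ hirr hcong hr0 hrk hfin h3 hD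
  exact crudeTransferUpperUnit_of_transfer_of_torsionFree hGZK hCT hT W G hirr hcong hr0 hrk hfin h3 hD
    (htors W G hirr hcong)

end Summit.BirchSwinnertonDyer.Rank1Residual.O5

end
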